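import Mathlib.LinearAlgebra.Matrix.Determinant.Basic
import Mathlib.RingTheory.MatrixAlgebra
import Mathlib.GroupTheory.Perm.Cycle.Type
import Literature.Computability.AlgebraicComplexity.ValiantClasses
import HarnessLib

/-!
# The signed even-cycle-cover family: a `VNP` witness (colourings and a determinant)

The *signed even-cycle-cover polynomial* of order `n` is the generalized matrix function

  `D^even_n (X) = ∑_{σ ∈ 𝔖_n, σ fixed-point free, all cycles of even length} sgn(σ) ∏ᵢ X_{σ i, i}`

(`evenCycleCoverPoly`; the coefficient function `σ ↦ sgn σ · [σ ∈ Π^even]` is a class function on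
`𝔖_n`, and `D^even` is the determinant on skew-symmetric matrices). By Valiant's criterion
(Valiant 1979; Bürgisser 2000, Prop. 2.20: coefficients in `{0, ±1}` computable in polynomial
time) the family `(D^even_n)_n` is in `VNP`. This file gives an explicit algebraic witness instead
of the Boolean-circuit one:

  `D^even_n (X) = ∑_{κ : [n] → K} det ( W (κ i) (κ j) · X_{j i} )_{j,i}`

where `K = [n] × {0,1}` is a set of `2n` colours and `W = transferMatrix γ` is the block matrix
`⊕_s [[0, 1], [γ_s, 0]]` whose closed-walk sums are `tr (W ^ ℓ) = [ℓ even] · 2 ∑_s γ_s^{ℓ/2}`.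
Indeed `det` of the coloured matrix is `∑_σ sgn σ ∏ᵢ W (κ i) (κ (σ i)) X_{σ i, i}`, and summing
over the colourings `κ` gives the factor `∑_κ ∏ᵢ W (κ i) (κ (σ i)) = ∏_{ℓ ∈ type σ} tr (W ^ ℓ)`
(`Literature.LinearAlgebra.Matrix.colouringSum_eq_prod_cycleType`), which is the indicator of
"fixed-point free with all cycles even" as soon as `∑_s γ_s ^ m = 1/2` for `1 ≤ m ≤ n`
(such `γ` exist over an algebraically closed field of characteristic zero,
`Literature.RingTheory.MvPolynomial.exists_powerSum_eq`). The colourings are encoded by Boolean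
variables `Z_{(i,a)}` ("vertex `i` has colour `a`") recognised by the one-hot products
`∏ᵢ ∏_{a ≠ b} (1 - Z_{ia} Z_{ib}) · ∏ᵢ ∑_a Z_{ia}` (as in BCS 1997, Prop. (21.15)), so that the
Boolean sum of `ecWitness = recogniser · det(coloured matrix)` over `{0,1}^{n · 2n}` is
`∑_σ sgn σ (∑_κ ∏ᵢ W (κ i) (κ (σ i))) ∏ᵢ X_{σ i, i}` (`boolSum_ecWitness_eq`, this file); the
identification with `D^even_n`, the size and degree bounds and the `VNP` membership are in
`EvenCycleCoverVNP.lean`.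

## References

* L. G. Valiant, *Completeness classes in algebra*, STOC 1979, §4 (Valiant's criterion).
* P. Bürgisser, *Completeness and Reduction in Algebraic Complexity Theory*, Springer 2000,
  Prop. 2.20, Def. 2.5.
* P. Bürgisser, M. Clausen, M. A. Shokrollahi, *Algebraic Complexity Theory*, Springer 1997,
  Prop. (21.15) (the permutation-matrix recogniser).
-/

noncomputable section

open MvPolynomial Equiv Finset

universe u

namespace Literature.Computability.AlgebraicComplexity

/-! ### The family -/

/-- The **signed even-cycle-cover polynomial** `D^even_n = ∑_{σ fixed-point free, all cycles even}
sgn(σ) ∏ᵢ X_{σ i, i}` in the `n²` variables `X_{ij}` (the generalized matrix function of the class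
function `sgn · [Π^even]`; Bürgisser 2000, §2.1 for generalized matrix functions as families).
[cite: Burgisser2000, Prop. 2.20] -/
def evenCycleCoverPoly (n : ℕ) (k : Type u) [CommRing k] : MvPolynomial (Fin n × Fin n) k :=
  ∑ σ : Perm (Fin n), C (if (∀ i, σ i ≠ i) ∧ (∀ m ∈ σ.cycleType, Even m)
    then ((Perm.sign σ : ℤ) : k) else 0) * ∏ i : Fin n, X (σ i, i)

/-! ### The transfer matrix `⊕_s [[0, 1], [γ_s, 0]]` -/

section Transfer

variable {n : ℕ} {k : Type u} [CommRing k]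

/-- The transfer matrix on the colours `Fin n × Fin 2`: the block sum over `s : Fin n` of
`[[0, 1], [γ s, 0]]`. [folklore] -/
def transferMatrix (γ : Fin n → k) : Matrix (Fin n × Fin 2) (Fin n × Fin 2) k :=
  Matrix.of fun p q => if p.1 = q.1 then
    (if p.2 = 0 ∧ q.2 = 1 then 1 else if p.2 = 1 ∧ q.2 = 0 then γ p.1 else 0) else 0

/-- The diagonal of the transfer matrix vanishes. [folklore] -/
theorem transferMatrix_apply_self (γ : Fin n → k) (p : Fin n × Fin 2) :
    transferMatrix γ p p = 0 := by
  simp only [transferMatrix, Matrix.of_apply, if_true]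
  have : p.2 = 0 ∨ p.2 = 1 := by omega
  rcases this with h | h <;> simp [h]

/-- `W² = diag (γ_s)`: each block squares to `γ_s · 1`. [folklore] -/
theorem transferMatrix_mul_self (γ : Fin n → k) :
    transferMatrix γ * transferMatrix γ = Matrix.diagonal fun p => γ p.1 := by
  ext p q
  rw [Matrix.mul_apply, Matrix.diagonal_apply]
  obtain ⟨s, b⟩ := p
  obtain ⟨t, c⟩ := q
  have hb : b = 0 ∨ b = 1 := by omega
  have hc : c = 0 ∨ c = 1 := by omega
  -- only the intermediate colour `(s, 1 - b)` contributes
  rw [Fintype.sum_eq_single (s, 1 - b)]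
  · rcases hb with rfl | rfl <;> rcases hc with rfl | rfl <;>
      by_cases hst : s = t <;> simp [transferMatrix, hst]
  · rintro ⟨s', b'⟩ hne
    have hb' : b' = 0 ∨ b' = 1 := by omega
    rcases hb with rfl | rfl <;> rcases hb' with rfl | rfl <;>
      by_cases hs : s = s' <;> simp_all [transferMatrix]

/-- Even powers: `W ^ (2m) = diag (γ_s ^ m)`. [folklore] -/
theorem transferMatrix_pow_two_mul (γ : Fin n → k) (m : ℕ) :
    transferMatrix γ ^ (2 * m) = Matrix.diagonal fun p => γ p.1 ^ m := by
  rw [pow_mul, pow_two, transferMatrix_mul_self, Matrix.diagonal_pow]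
  rfl

/-- `tr (W ^ (2m)) = 2 ∑_s γ_s ^ m`. [folklore] -/
theorem trace_transferMatrix_pow_two_mul (γ : Fin n → k) (m : ℕ) :
    (transferMatrix γ ^ (2 * m)).trace = 2 * ∑ s, γ s ^ m := by
  rw [transferMatrix_pow_two_mul, Matrix.trace_diagonal, Fintype.sum_prod_type]
  simp only [Fin.sum_univ_two]
  rw [Finset.sum_add_distrib, two_mul]

/-- `tr (W ^ (2m+1)) = 0` (the diagonal of `diag · W` vanishes with that of `W`). [folklore] -/
theorem trace_transferMatrix_pow_two_mul_add_one (γ : Fin n → k) (m : ℕ) :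
    (transferMatrix γ ^ (2 * m + 1)).trace = 0 := by
  rw [pow_succ, transferMatrix_pow_two_mul, Matrix.trace]
  refine Finset.sum_eq_zero fun p _ => ?_
  rw [Matrix.diag_apply, Matrix.mul_apply, Fintype.sum_eq_single p]
  · rw [transferMatrix_apply_self, mul_zero]
  · intro q hq
    rw [Matrix.diagonal_apply_ne _ (Ne.symm hq), zero_mul]

/-- **Closed-walk sums of the transfer matrix.** If `∑_s γ_s ^ m = 1/2` for `1 ≤ m ≤ n`, then
`tr (W ^ ℓ) = [ℓ even]` for `1 ≤ ℓ ≤ n`. [folklore] -/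
theorem trace_transferMatrix_pow (γ : Fin n → k)
    (hγ : ∀ m, 1 ≤ m → m ≤ n → 2 * ∑ s, γ s ^ m = 1) (ℓ : ℕ) (h1 : 1 ≤ ℓ) (hn : ℓ ≤ n) :
    (transferMatrix γ ^ ℓ).trace = if Even ℓ then 1 else 0 := by
  rcases Nat.even_or_odd ℓ with ⟨m, rfl⟩ | ⟨m, rfl⟩
  · rw [if_pos (by simp), ← two_mul, trace_transferMatrix_pow_two_mul]
    exact hγ m (by omega) (by omega)
  · rw [if_neg (Nat.not_even_iff_odd.2 ⟨m, rfl⟩), trace_transferMatrix_pow_two_mul_add_one]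

end Transfer

/-! ### The one-hot recogniser of function graphs -/

section Recogniser

variable {ι : Type*} [Fintype ι] [DecidableEq ι] {K : Type*} [Fintype K] [DecidableEq K]
  {A : Type*} [CommRing A]

/-- The graph of a colouring `κ : ι → K` as a Boolean matrix, entry `(i, a)` being `[κ i = a]`.
[folklore] -/
def fnGraph (κ : ι → K) : ι × K → Bool := fun p => decide (κ p.1 = p.2)

omit [Fintype ι] [DecidableEq ι] [Fintype K] in
/-- A colouring is determined by its graph. [folklore] -/
theorem fnGraph_injective : Function.Injective (fnGraph (ι := ι) (K := K)) := by
  intro κ κ' h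
  funext i
  have h1 := congrFun h (i, κ i)
  simp only [fnGraph, decide_true, true_eq_decide_iff] at h1
  exact h1.symm

/-- The one-hot recogniser `∏ᵢ ∏_{a ≠ b} (1 - E_{ia} E_{ib}) · ∏ᵢ ∑_a E_{ia}` at a Boolean
matrix `E` (BCS 1997, proof of Prop. (21.15), rows only). [cite: BurgisserClausenShokrollahi1997, Prop. (21.15)] -/
def oneHotRec (E : ι × K → Bool) : A :=
  (∏ i : ι, ∏ ab ∈ (univ : Finset (K × K)).filter (fun ab => ab.1 ≠ ab.2),
      (1 - (if E (i, ab.1) then (1 : A) else 0) * (if E (i, ab.2) then (1 : A) else 0))) *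
    ∏ i : ι, ∑ a : K, (if E (i, a) then (1 : A) else 0)

omit [DecidableEq ι] in
/-- At the graph of a colouring the recogniser is `1`. [cite: BurgisserClausenShokrollahi1997, Prop. (21.15)] -/
theorem oneHotRec_fnGraph (κ : ι → K) : oneHotRec (A := A) (fnGraph κ) = 1 := by
  unfold oneHotRec
  have hα : ∀ i : ι, ∀ ab ∈ (univ : Finset (K × K)).filter (fun ab => ab.1 ≠ ab.2),
      (1 - (if fnGraph κ (i, ab.1) then (1 : A) else 0) *
        (if fnGraph κ (i, ab.2) then (1 : A) else 0)) = 1 := by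
    rintro i ⟨a, b⟩ hab
    simp only [Finset.mem_filter, Finset.mem_univ, true_and] at hab
    by_cases ha : κ i = a
    · have hb : κ i ≠ b := fun h => hab (ha.symm.trans h)
      simp [fnGraph, hb]
    · simp [fnGraph, ha]
  have hβ : ∀ i : ι, (∑ a : K, (if fnGraph κ (i, a) then (1 : A) else 0)) = 1 := by
    intro i
    simp [fnGraph, Finset.sum_ite_eq]
  rw [Finset.prod_eq_one fun i _ => Finset.prod_eq_one (hα i), Finset.prod_eq_one fun i _ => hβ i,
    one_mul]

omit [DecidableEq ι] in
/-- Away from graphs of colourings the recogniser vanishes: either a row carries two `1`s (a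
factor `1 - 1·1`), or a row is empty (a factor `∑ = 0`), or every row is one-hot and `E` is a
graph. [cite: BurgisserClausenShokrollahi1997, Prop. (21.15)] -/
theorem oneHotRec_eq_zero {E : ι × K → Bool} (hE : ∀ κ : ι → K, fnGraph κ ≠ E) :
    oneHotRec (A := A) E = 0 := by
  classical
  unfold oneHotRec
  by_cases h1 : ∃ i, ∃ ab ∈ (univ : Finset (K × K)).filter (fun ab => ab.1 ≠ ab.2),
      E (i, ab.1) = true ∧ E (i, ab.2) = true
  · obtain ⟨i, ab, hab, ha, hb⟩ := h1
    rw [Finset.prod_eq_zero (Finset.mem_univ i) (Finset.prod_eq_zero hab (by simp [ha, hb])),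
      zero_mul]
  push Not at h1
  by_cases h2 : ∃ i, ∀ a, E (i, a) = false
  · obtain ⟨i, hi⟩ := h2
    apply mul_eq_zero_of_right
    exact Finset.prod_eq_zero (Finset.mem_univ i) (by simp [hi])
  push Not at h2
  exfalso
  choose v hv using h2
  have hv' : ∀ i, E (i, v i) = true := fun i => by simpa using hv i
  apply hE v
  funext ⟨i, a⟩
  simp only [fnGraph]
  by_cases ha : E (i, a) = true
  · rw [ha, decide_eq_true_eq]
    by_contra hne
    have hmem : (v i, a) ∈ (univ : Finset (K × K)).filter (fun ab => ab.1 ≠ ab.2) :=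
      Finset.mem_filter.2 ⟨Finset.mem_univ _, hne⟩
    exact h1 i _ hmem (hv' i) ha
  · rw [Bool.not_eq_true] at ha
    rw [ha, decide_eq_false_iff_not]
    intro h
    rw [← h, hv'] at ha
    exact Bool.noConfusion ha

/-- **Boolean sums against the one-hot recogniser are sums over colourings**:
`∑_{E ∈ {0,1}^{ι × K}} rec(E) G(E) = ∑_{κ : ι → K} G(graph κ)`. [cite: BurgisserClausenShokrollahi1997, Prop. (21.15)] -/
theorem sum_oneHotRec_mul (G : (ι × K → Bool) → A) :
    ∑ E : ι × K → Bool, oneHotRec E * G E = ∑ κ : ι → K, G (fnGraph κ) := by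
  classical
  have h : ∀ E : ι × K → Bool, oneHotRec E * G E =
      if ∃ κ : ι → K, fnGraph κ = E then G E else 0 := by
    intro E
    split_ifs with hκ
    · obtain ⟨κ, rfl⟩ := hκ
      rw [oneHotRec_fnGraph, one_mul]
    · push Not at hκ
      rw [oneHotRec_eq_zero hκ, zero_mul]
  rw [Finset.sum_congr rfl fun E _ => h E, ← Finset.sum_filter]
  have hfi : (Finset.univ.filter fun E : ι × K → Bool => ∃ κ : ι → K, fnGraph κ = E) =
      Finset.univ.image fnGraph := by
    ext E
    simp
  rw [hfi, Finset.sum_image fun κ _ κ' _ h => fnGraph_injective h]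

end Recogniser

/-! ### The witness -/

section Witness

variable (n : ℕ) (k : Type u) [CommRing k]

/-- The variables of the witness: the `n²` matrix variables (`Sum.inl`) and the `n · 2n` Boolean
colour variables `Z_{(i,a)}`, `a ∈ Fin n × Fin 2`, enumerated by `Fin (n * (n * 2))`
(`colourVarEquiv`) as `IsVNPFamily` requires. [cite: Burgisser2000, Def. 2.5] -/
abbrev ECVars : Type :=
  (Fin n × Fin n) ⊕ Fin (n * (n * 2))

/-- The enumeration of the colour variables `(i, (s, b)) ↦ Fin (n * (n * 2))`. [folklore] -/
def colourVarEquiv : Fin n × (Fin n × Fin 2) ≃ Fin (n * (n * 2)) :=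
  (Equiv.prodCongr (Equiv.refl _) finProdFinEquiv).trans finProdFinEquiv

/-- The colour variable `Z_{(i,a)}`. [folklore] -/
def zVar (p : Fin n × (Fin n × Fin 2)) : MvPolynomial (ECVars n) k :=
  X (Sum.inr (colourVarEquiv n p))

/-- The one-hot recogniser on the colour variables:
`∏ᵢ ∏_{a ≠ b} (1 - Z_{ia} Z_{ib}) · ∏ᵢ ∑_a Z_{ia}`. [cite: BurgisserClausenShokrollahi1997, Prop. (21.15)] -/
def ecRecogniser : MvPolynomial (ECVars n) k :=
  (∏ i : Fin n, ∏ ab ∈ (univ : Finset ((Fin n × Fin 2) × (Fin n × Fin 2))).filter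
      (fun ab => ab.1 ≠ ab.2), (1 - zVar n k (i, ab.1) * zVar n k (i, ab.2))) *
    ∏ i : Fin n, ∑ a : Fin n × Fin 2, zVar n k (i, a)

variable {n} in
/-- The coloured matrix `(∑_{a,b} Z_{ia} Z_{jb} W_{ab}) · X_{ji}`. [folklore] -/
def ecMatrix (γ : Fin n → k) : Matrix (Fin n) (Fin n) (MvPolynomial (ECVars n) k) :=
  Matrix.of fun j i => (∑ a : Fin n × Fin 2, ∑ b : Fin n × Fin 2,
    zVar n k (i, a) * zVar n k (j, b) * C (transferMatrix γ a b)) * X (Sum.inl (j, i))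

variable {n} in
/-- **The `VNP` witness** for `D^even_n`: recogniser times the determinant of the coloured
matrix. [cite: Burgisser2000, Prop. 2.20] -/
def ecWitness (γ : Fin n → k) : MvPolynomial (ECVars n) k :=
  ecRecogniser n k * (ecMatrix k γ).det

end Witness

/-! ### The Boolean sum of the witness -/

section BoolSum

variable {n : ℕ} {k : Type u} [CommRing k]

/-- The coloured matrix at the graph of a colouring `κ`: entry `(j, i)` is
`W (κ i) (κ j) · X_{ji}`. [folklore] -/
def colMatrix (γ : Fin n → k) (κ : Fin n → Fin n × Fin 2) :
    Matrix (Fin n) (Fin n) (MvPolynomial (Fin n × Fin n) k) :=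
  Matrix.of fun j i => C (transferMatrix γ (κ i) (κ j)) * X (j, i)

/-- **Determinant of the coloured matrix**:
`det (W (κ i) (κ j) X_{ji}) = ∑_σ sgn σ · (∏ᵢ W (κ i) (κ (σ i))) · ∏ᵢ X_{σ i, i}`. [folklore] -/
theorem det_colMatrix (γ : Fin n → k) (κ : Fin n → Fin n × Fin 2) :
    (colMatrix γ κ).det = ∑ σ : Perm (Fin n),
      C (((Perm.sign σ : ℤ) : k) * ∏ i, transferMatrix γ (κ i) (κ (σ i))) *
        ∏ i, X (σ i, i) := by
  rw [Matrix.det_apply]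
  refine Finset.sum_congr rfl fun σ _ => ?_
  simp only [colMatrix, Matrix.of_apply]
  rw [Finset.prod_mul_distrib, ← map_prod, Units.smul_def, zsmul_eq_mul, map_mul, mul_assoc]
  congr 1

/-- The substitution of a Boolean point `E` of the colour block (free variables unchanged).
[cite: Burgisser2000, Def. 2.5] -/
def ecBoolPoint (E : Fin n × (Fin n × Fin 2) → Bool) :
    ECVars n → MvPolynomial (Fin n × Fin n) k :=
  Sum.elim X fun j => if E ((colourVarEquiv n).symm j) then 1 else 0

/-- At a Boolean point, `Z_p ↦ [E p]`. [folklore] -/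
theorem aeval_ecBoolPoint_zVar (E : Fin n × (Fin n × Fin 2) → Bool) (p : Fin n × (Fin n × Fin 2)) :
    aeval (ecBoolPoint (k := k) E) (zVar n k p) = if E p then 1 else 0 := by
  simp [zVar, ecBoolPoint]

/-- At a Boolean point the recogniser becomes `oneHotRec E`. [folklore] -/
theorem aeval_ecBoolPoint_ecRecogniser (E : Fin n × (Fin n × Fin 2) → Bool) :
    aeval (ecBoolPoint (k := k) E) (ecRecogniser n k) = oneHotRec E := by
  unfold ecRecogniser oneHotRec
  simp only [map_mul, map_prod, map_sum, map_sub, map_one, aeval_ecBoolPoint_zVar]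

/-- At the graph of `κ` the coloured matrix becomes `colMatrix γ κ`. [folklore] -/
theorem aeval_fnGraph_ecMatrix_det (γ : Fin n → k) (κ : Fin n → Fin n × Fin 2) :
    aeval (ecBoolPoint (k := k) (fnGraph κ)) (ecMatrix k γ).det = (colMatrix γ κ).det := by
  rw [AlgHom.map_det]
  congr 1
  ext j i
  simp only [AlgHom.mapMatrix_apply, Matrix.map_apply, ecMatrix, colMatrix, Matrix.of_apply,
    map_mul, map_sum, aeval_ecBoolPoint_zVar, aeval_C, aeval_X, MvPolynomial.algebraMap_eq]
  simp only [ecBoolPoint, Sum.elim_inl]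
  congr 1
  simp only [fnGraph, decide_eq_true_eq]
  rw [Finset.sum_eq_single (κ i)]
  · rw [Finset.sum_eq_single (κ j)]
    · simp
    · intro b _ hb
      rw [if_neg (Ne.symm hb)]
      ring
    · simp
  · intro a _ ha
    refine Finset.sum_eq_zero fun b _ => ?_
    rw [if_neg (Ne.symm ha)]
    ring
  · simp

/-- **The Boolean sum of the witness** is
`∑_σ sgn σ · (∑_κ ∏ᵢ W (κ i) (κ (σ i))) · ∏ᵢ X_{σ i, i}` (the inner sum is the colouring sum
`Literature.LinearAlgebra.Matrix.colouringSum (transferMatrix γ) σ`). [cite: Burgisser2000, Prop. 2.20] -/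
theorem boolSum_ecWitness_eq (γ : Fin n → k) :
    boolSum (ecWitness k γ) = ∑ σ : Perm (Fin n),
      C (((Perm.sign σ : ℤ) : k) *
          ∑ κ : Fin n → Fin n × Fin 2, ∏ i, transferMatrix γ (κ i) (κ (σ i))) *
        ∏ i, X (σ i, i) := by
  unfold boolSum
  -- reindex the Boolean block by `Fin n × (Fin n × Fin 2)`
  have hre : ∀ e : Fin (n * (n * 2)) → Bool,
      (Sum.elim X fun j => if e j then (1 : MvPolynomial (Fin n × Fin n) k) else 0) =
        ecBoolPoint (e ∘ colourVarEquiv n) := by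
    intro e
    funext v
    cases v with
    | inl q => rfl
    | inr j => simp [ecBoolPoint]
  simp only [hre]
  rw [← Equiv.sum_comp (Equiv.arrowCongr (colourVarEquiv n) (Equiv.refl Bool))]
  have hcomp : ∀ E : Fin n × (Fin n × Fin 2) → Bool,
      ((Equiv.arrowCongr (colourVarEquiv n) (Equiv.refl Bool)) E) ∘ colourVarEquiv n = E := by
    intro E
    funext p
    simp
  simp only [hcomp, ecWitness, map_mul, aeval_ecBoolPoint_ecRecogniser]
  rw [sum_oneHotRec_mul fun E => aeval (ecBoolPoint E) (ecMatrix k γ).det]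
  simp only [aeval_fnGraph_ecMatrix_det, det_colMatrix]
  rw [Finset.sum_comm]
  refine Finset.sum_congr rfl fun σ _ => ?_
  rw [← Finset.sum_mul]
  congr 1
  rw [← map_sum, ← Finset.mul_sum, map_mul]

end BoolSum

end Literature.Computability.AlgebraicComplexity
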